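import Summits.QuantumFields.YangMills.Theorems.UnitScaleTiltProp7ZetaRowOfEngineRowsAbs
import Summits.QuantumFields.YangMills.Theorems.UnitScaleTiltProp7RowHOfLocalModelRowsPt
import Summits.QuantumFields.YangMills.Theorems.UnitScaleTiltProp7CoclosedEnergiesOfHKgK
import HarnessLib

/-!
# Route `UnitScaleTilt`, crux K1 child «MinimiserStabilityRegPr» (stmt-QuantumFields-19200) — route-R E′, growth side: THE E′ DISPLAY v4 (pointwise junction + absorbed divergence slot).
# E′ ⇐ (E1) ∧ hKg-K ∧ {hRes, hDir, hGJ_pt} ∧ (P′) — over the R5 door v2 ✓`Prop7ZetaRowOfEngineRowsAbs` (row (P′) = (P) `+ η·ℓ·DIV(D)`, `2C_Hη ≤ 1`), rows (H) and (B)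
# discharged by ✓`Prop7RowHOfLocalModelRowsPt.rowH_of_localModelRows_pt` and ✓`Prop7CoclosedEnergiesOfHKgK.rowB_of_hKgK_T3` (px12)

Cell `ym3-torus` ∕ fleet seat `ym-ust-19200-p1` (gen 16, route-R E′ lead ∕ namer; RULING (P) v1.1, NAMER WORD 10, 2026-08-28 23:55Z).  THEOREMS ONLY (0 `def`, 0 `sorry`);
`--supports stmt-QuantumFields-19200`, count-neutral.  YM₃ on T³ is a ladder rung (R3), not the Clay problem; nothing here claims the stub, the crux, d = 4 or the mass gap; E′ is NOT
closed by this file — its rows are DISPLAYED.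

WHY.  ✓p679301 is the E′ candidate display «(E1) ∧ hKg-K ∧ {hRes,hDir,hGJ_pt} ∧ (P)».  routeR-w2 g6 located (23:53Z) that the linearisation-defect row hq of (P)'s chain carries, from the
landed tower, a term `A_K·sQ²·ℓ·DIV₁₁₆` with `DIV₁₁₆ =` the door's own `DIV(D)`; it cannot be booked in (K)∕(M)∕(eM) but is ABSORBED by the door v2 (factor 2 on `ζ`, `δ₁`).  This file
is ✓p679301 over the v2 door: the displayed (P′) carries the slot `+ η·ℓ·DIV(D)` and the constants the condition `2·C_H·η ≤ 1` (an L-only smallness on `sQ` at the knit of (P′)).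
Everything else VERBATIM as ✓p679301.

WHAT IS PROVED (ns `…Theorems.Prop7PV3EOfPinnedSliceAndRawRowsAbs`): ★★★ `stub_PV3E_of_pinnedSliceAndRawRows_abs` (E′ text VERBATIM).
HONEST SCOPE.  Composition of landed theorems; every analytic row is DISPLAYED; hKg-K∕hRes∕hDir∕hGJ_pt inhabited numerically only; no constant of Bałaban's is asserted.

References: T. Bałaban, CMP 102 (1985) 277–309 [Balaban1985Variational] ((4)–(7) p.278, (47)–(48) pp.285–286, (116) p.295, (141)–(143), Prop. 7 p.299); CMP 99 (1985) 389–434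
[Balaban1985BackgroundPropagators] ((3.3)–(3.4) pp.390–391, (3.8)–(3.11) p.392, Thm 3.11 p.416); CMP 99 (1985) 75–102 [Balaban1985RegularSpaces] ((1.14) p.78, Thm 2 p.83);
CMP 95 (1984) 17–40 [Balaban1984PropagatorsI] ((1.21) p.21, Prop. 1.1 (1.90) p.33).
-/

set_option autoImplicit false
noncomputable section

open scoped BigOperators Matrix.Norms.L2Operator Matrix

namespace Summit.QuantumFields.YangMills.Theorems.Prop7PV3EOfPinnedSliceAndRawRowsAbs

open Literature.MathematicalPhysics.QuantumFieldTheory.Balaban1983to89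
open Literature.MathematicalPhysics.QuantumFieldTheory.Balaban1983to89.T3ContinuumYM3Torus
open Literature.MathematicalPhysics.QuantumFieldTheory.Balaban1983to89.T3Thm1Carrier
open Literature.MathematicalPhysics.QuantumFieldTheory.Balaban1983to89.T3PrintedRegularMinimiser
open Literature.MathematicalPhysics.QuantumFieldTheory.Balaban1983to89.T3RegularMinimiser
open Literature.MathematicalPhysics.QuantumFieldTheory.Balaban1983to89.T3Thm1CarrierNative (IsCritR2)
open Literature.MathematicalPhysics.QuantumFieldTheory.Balaban1983to89.T3SectALandauChart (CloseAvg)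
open T4Continuum BlockAveraging AveragingRT ExpMeanLog
open MatrixLog (mlog)
open B9Eq39Adjoint (R covD covDstar divB curl)
open B10Eq27TorusAxialLog (unitsField toUField)
open B9TorusCalculus (torusT)
open B5Eq118OneStroke (iterBlockOf)
open B15DeterminingSets (embIter)
open Summit.QuantumFields.YangMills.Theorems.Prop7ZetaRowOfEngineRowsAbs (stub_PV3E_of_pinnedSliceAndEngineRows_abs)
open Summit.QuantumFields.YangMills.Theorems.Prop7RowHOfLocalModelRows (covLapLap_eq_zero_of_split)
open Summit.QuantumFields.YangMills.Theorems.Prop7RowHOfLocalModelRowsPt (rowH_of_localModelRows_pt)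
open Summit.QuantumFields.YangMills.Theorems.Prop7CoclosedEnergiesOfHKgK (rowB_of_hKgK_T3 dist1_plaqHol_le_of_mem_regFibrePr)

set_option maxHeartbeats 400000 in
/-- ★★★ **E′ ⇐ (E1) ∧ hKg-K ∧ {hRes, hDir, hGJ_pt} ∧ (P′)** (pointwise junction, absorbed divergence slot).  Per `L > 1`: `e₆ sQ ζ δ₁` with the windows of ✓p666280 VERBATIM,
(E1) VERBATIM, 15 constants (signs, `2·C_H·η ≤ 1`, the doubled bookkeeping inequalities) such that at every member and every co-closed covariant Hodge split of the chart of an exactly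
`S_H`-gauged fibre point of an R2-critical `W ∈ (6)(e) ∩ 𝔅_k(V)` the DISPLAYED rows hKg-K, hRes∕hDir∕hGJ_pt (for some local models and recentring) and (P′) hold.  CONCLUSION = E′.
[cite: Balaban1985Variational, (141)-(143) p.299, Prop. 7 p.299, (4)-(7) p.278, (47)-(48) pp.285-286, (116) p.295; Balaban1985BackgroundPropagators, (3.3)-(3.4) pp.390-391, (3.8)-(3.11) p.392, Thm 3.11 p.416; Balaban1985RegularSpaces, (1.14) p.78, Thm 2 p.83; Balaban1984PropagatorsI, Prop. 1.1 (1.90) p.33] -/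
theorem stub_PV3E_of_pinnedSliceAndRawRows_abs
    (hrows : ∀ (L : ℕ), 1 < L → ∃ e₆ sQ ζ δ₁ : ℝ, 0 < e₆ ∧ 100000000000000 * (L : ℝ) ^ 9 * e₆ ≤ 1 ∧ 0 ≤ sQ ∧ 8 * sQ ≤ 1 ∧
      800000000000 * (L : ℝ) ^ 9 * sQ ≤ 1 ∧ 0 ≤ ζ ∧ 0 ≤ δ₁ ∧ δ₁ < 4 * (1 / (128 * (18 + 537600 * (L : ℝ) ^ 4))) ∧
      16 * e₆ * ((8 * ((3 / 2) * (694800 * (L : ℝ) ^ 5) * (28800 * (L : ℝ) ^ 4) * ((L : ℝ) ^ 2 / ((L : ℝ) ^ 3 - 1)))) * (1 + ζ)) ≤ 1 ∧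
      15552 * (2 * sQ) ^ 2 + 216 * e₆ + 2 * e₆ * ((2 * ((3 / 2) * (694800 * (L : ℝ) ^ 5) * (7 * ((L : ℝ) ^ 2 / ((L : ℝ) - 1)) + 600000 * (L : ℝ) ^ 4 * ((L : ℝ) ^ 2 / ((L : ℝ) ^ 3 - 1)))) + 322608 * ((3 / 2) * (694800 * (L : ℝ) ^ 5) * (28800 * (L : ℝ) ^ 4) * ((L : ℝ) ^ 2 / ((L : ℝ) ^ 3 - 1))))
        + (8 * ((3 / 2) * (694800 * (L : ℝ) ^ 5) * (28800 * (L : ℝ) ^ 4) * ((L : ℝ) ^ 2 / ((L : ℝ) ^ 3 - 1)))) * δ₁)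
        ≤ (((1 / (128 * (18 + 537600 * (L : ℝ) ^ 4))) - δ₁ / 4) / (1 + ζ / 4)) / 8 ∧
      -- (E1) the pinned slice theorem: an exactly S_H-gauged fibre point per competitor
      (∀ (F : T3Family), F.L = L → ∀ (n K : ℕ) (hnK : n < K) (e : ℝ) (V : GaugeField (F.P n) 0 (Matrix.specialUnitaryGroup (Fin 2) ℂ))
        (W : GaugeField (F.P K) 0 (Matrix.specialUnitaryGroup (Fin 2) ℂ)),
        0 < e → e ≤ e₆ → W ∈ regFibrePr F n K hnK.le e V → IsCritR2 F n K hnK.le V W →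
        ∀ W' : GaugeField (F.P K) 0 (Matrix.specialUnitaryGroup (Fin 2) ℂ), W' ∈ regFibrePr F n K hnK.le e V →
          ∃ Y : GaugeField (F.P K) 0 (Matrix.specialUnitaryGroup (Fin 2) ℂ), Y ∈ regFibrePr F n K hnK.le e V ∧ wilsonAction4 W' = wilsonAction4 Y ∧
            (∀ b : PBond (F.P K) 0, ‖((Y b * (W b)⁻¹ : Matrix.specialUnitaryGroup (Fin 2) ℂ) : Matrix (Fin 2) (Fin 2) ℂ) - 1‖
              ≤ sQ * ((F.L : ℝ) ^ (K - n))⁻¹) ∧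
            (∀ x : Site (F.P K) 0, x ∉ Set.range (embIter (K - n)) →
              divB (torusT (F.P K) 0) (fun κ z => unitsField (toUField W) ⟨z, κ⟩)
                (fun μ z => covD (torusT (F.P K) 0) (fun κ z => unitsField (toUField W) ⟨z, κ⟩) μ
                  (fun y => divB (torusT (F.P K) 0) (fun κ z => unitsField (toUField W) ⟨z, κ⟩)
                    (fun κ z => Complex.I • ((-Complex.I) • mlog ((Y ⟨z, κ⟩ * (W ⟨z, κ⟩)⁻¹ : Matrix.specialUnitaryGroup (Fin 2) ℂ) : Matrix (Fin 2) (Fin 2) ℂ))) y) z) x = 0)) ∧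
      -- (S3) REPLACED BY: hKg-K ∧ {hRes, hDir, hGJ_pt} ∧ (P′)
      (∃ C_H ζ_R θ_R ζ_D θ_D ζ_G θ_G ζ_P θ θ_P C_P C_Λ C_g θ_g η : ℝ,
        0 ≤ C_H ∧ 0 ≤ θ_R ∧ 0 ≤ θ_D ∧ 0 ≤ θ_G ∧ 0 < θ ∧ 0 ≤ θ_P ∧ 0 ≤ C_P ∧ 0 ≤ C_Λ ∧ 0 ≤ θ_g ∧ 2 * C_H * η ≤ 1 ∧
        2 * (C_H * ζ_P / θ + (ζ_R + ζ_D + ζ_G) + C_H * (C_P + C_Λ) * (16 * (1 + C_g))) ≤ ζ ∧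
        2 * (C_H * θ + e₆ * (C_H * θ_P + (θ_R + θ_D + θ_G) + C_H * (C_P + C_Λ) * (16 * θ_g + 792))) ≤ δ₁ ∧
      ∀ (F : T3Family), F.L = L → ∀ (n K : ℕ) (hnK : n < K) (e : ℝ) (V : GaugeField (F.P n) 0 (Matrix.specialUnitaryGroup (Fin 2) ℂ))
        (W : GaugeField (F.P K) 0 (Matrix.specialUnitaryGroup (Fin 2) ℂ)),
        0 < e → e ≤ e₆ → W ∈ regFibrePr F n K hnK.le e V → IsCritR2 F n K hnK.le V W →
        ∀ Y : GaugeField (F.P K) 0 (Matrix.specialUnitaryGroup (Fin 2) ℂ), Y ∈ regFibrePr F n K hnK.le e V →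
          (∀ b : PBond (F.P K) 0, ‖((Y b * (W b)⁻¹ : Matrix.specialUnitaryGroup (Fin 2) ℂ) : Matrix (Fin 2) (Fin 2) ℂ) - 1‖
              ≤ sQ * ((F.L : ℝ) ^ (K - n))⁻¹) →
          (∀ x : Site (F.P K) 0, x ∉ Set.range (embIter (K - n)) →
              divB (torusT (F.P K) 0) (fun κ z => unitsField (toUField W) ⟨z, κ⟩)
                (fun μ z => covD (torusT (F.P K) 0) (fun κ z => unitsField (toUField W) ⟨z, κ⟩) μ
                  (fun y => divB (torusT (F.P K) 0) (fun κ z => unitsField (toUField W) ⟨z, κ⟩)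
                    (fun κ z => Complex.I • ((-Complex.I) • mlog ((Y ⟨z, κ⟩ * (W ⟨z, κ⟩)⁻¹ : Matrix.specialUnitaryGroup (Fin 2) ℂ) : Matrix (Fin 2) (Fin 2) ℂ))) y) z) x = 0) →
          ∀ D : PBond (F.P K) 0 → Matrix (Fin 2) (Fin 2) ℂ,
            D = (fun b => (-Complex.I) • mlog ((Y b * (W b)⁻¹ : Matrix.specialUnitaryGroup (Fin 2) ℂ) : Matrix (Fin 2) (Fin 2) ℂ)) →
          ∀ (B : PBond (F.P K) 0 → Matrix (Fin 2) (Fin 2) ℂ) (φ₀ : Site (F.P K) 0 → Matrix (Fin 2) (Fin 2) ℂ),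
            (∀ b : PBond (F.P K) 0, D b = B b + covD (torusT (F.P K) 0) (fun κ z => unitsField (toUField W) ⟨z, κ⟩) b.dir φ₀ b.src) →
            (∀ x : Site (F.P K) 0, divB (torusT (F.P K) 0) (fun κ z => unitsField (toUField W) ⟨z, κ⟩) (fun κ z => B ⟨z, κ⟩) x = 0) →
            -- hKg-K at `IsCritR2 W` (DISPLAYED): the local commutator energy of the Hodge potential
            (∀ Dφ : PBond (F.P K) 0 → Matrix (Fin 2) (Fin 2) ℂ, (∀ b : PBond (F.P K) 0, Dφ b = covD (torusT (F.P K) 0) (fun κ z => unitsField (toUField W) ⟨z, κ⟩) b.dir φ₀ b.src) →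
              (∑ p : Plaq (F.P K) 0, ‖((Complex.I • Dφ ⟨p.src, p.μ⟩) + ((W ⟨p.src, p.μ⟩ : Matrix (Fin 2) (Fin 2) ℂ) * (Complex.I • Dφ ⟨p.src.shift p.μ, p.ν⟩) * star (W ⟨p.src, p.μ⟩ : Matrix (Fin 2) (Fin 2) ℂ))
            - (((W ⟨p.src, p.μ⟩ * W ⟨p.src.shift p.μ, p.ν⟩ * (W ⟨p.src.shift p.ν, p.μ⟩)⁻¹ : Matrix.specialUnitaryGroup (Fin 2) ℂ) : Matrix (Fin 2) (Fin 2) ℂ) * (Complex.I • Dφ ⟨p.src.shift p.ν, p.μ⟩) * star ((W ⟨p.src, p.μ⟩ * W ⟨p.src.shift p.μ, p.ν⟩ * (W ⟨p.src.shift p.ν, p.μ⟩)⁻¹ : Matrix.specialUnitaryGroup (Fin 2) ℂ) : Matrix (Fin 2) (Fin 2) ℂ))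
            - (((GaugeField.plaqHol W p : Matrix.specialUnitaryGroup (Fin 2) ℂ) : Matrix (Fin 2) (Fin 2) ℂ) * (Complex.I • Dφ ⟨p.src, p.ν⟩) * star ((GaugeField.plaqHol W p : Matrix.specialUnitaryGroup (Fin 2) ℂ) : Matrix (Fin 2) (Fin 2) ℂ)))‖ ^ 2)
                ≤ C_g * (∑ p : Plaq (F.P K) 0, ‖((Complex.I • D ⟨p.src, p.μ⟩) + ((W ⟨p.src, p.μ⟩ : Matrix (Fin 2) (Fin 2) ℂ) * (Complex.I • D ⟨p.src.shift p.μ, p.ν⟩) * star (W ⟨p.src, p.μ⟩ : Matrix (Fin 2) (Fin 2) ℂ))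
            - (((W ⟨p.src, p.μ⟩ * W ⟨p.src.shift p.μ, p.ν⟩ * (W ⟨p.src.shift p.ν, p.μ⟩)⁻¹ : Matrix.specialUnitaryGroup (Fin 2) ℂ) : Matrix (Fin 2) (Fin 2) ℂ) * (Complex.I • D ⟨p.src.shift p.ν, p.μ⟩) * star ((W ⟨p.src, p.μ⟩ * W ⟨p.src.shift p.μ, p.ν⟩ * (W ⟨p.src.shift p.ν, p.μ⟩)⁻¹ : Matrix.specialUnitaryGroup (Fin 2) ℂ) : Matrix (Fin 2) (Fin 2) ℂ))
            - (((GaugeField.plaqHol W p : Matrix.specialUnitaryGroup (Fin 2) ℂ) : Matrix (Fin 2) (Fin 2) ℂ) * (Complex.I • D ⟨p.src, p.ν⟩) * star ((GaugeField.plaqHol W p : Matrix.specialUnitaryGroup (Fin 2) ℂ) : Matrix (Fin 2) (Fin 2) ℂ)))‖ ^ 2)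
                  + θ_g * e * (((F.L : ℝ) ^ (K - n)) ^ 2)⁻¹ * (∑ b : PBond (F.P K) 0, ‖D b‖ ^ 2)) ∧
            -- the three LOCAL-MODEL rows of LEMMA-H-CURVED, POINTWISE RECENTRING (DISPLAYED): hRes, hDir, hGJ_pt for SOME local models `Ψ` and recentring `Z`
            (∃ (Ψ : Site (F.P K) (K - n) → Site (F.P K) 0 → Matrix (Fin 2) (Fin 2) ℂ)
                (Z : Fin (F.P K).d → Site (F.P K) 0 → Matrix (Fin 2) (Fin 2) ℂ),
              (∀ y, Ψ y (embIter (K - n) y) = φ₀ (embIter (K - n) y)) ∧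
              6 * (∑ y : Site (F.P K) (K - n), ∑ z : Site (F.P K) 0,
            (if (∀ ν : Fin (F.P K).d,
                (y ν = (iterBlockOf (K - n) (fun κ => z κ - (((((F.P K).L ^ (K - n) - 1) / 2 : ℕ)) : ZMod ((F.P K).sitesPerDir 0)))) ν - 1
                ∨ y ν = (iterBlockOf (K - n) (fun κ => z κ - (((((F.P K).L ^ (K - n) - 1) / 2 : ℕ)) : ZMod ((F.P K).sitesPerDir 0)))) ν
                ∨ y ν = (iterBlockOf (K - n) (fun κ => z κ - (((((F.P K).L ^ (K - n) - 1) / 2 : ℕ)) : ZMod ((F.P K).sitesPerDir 0)))) ν + 1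
                ∨ y ν = (iterBlockOf (K - n) (fun κ => z κ - (((((F.P K).L ^ (K - n) - 1) / 2 : ℕ)) : ZMod ((F.P K).sitesPerDir 0)))) ν + 2))
              then ‖divB (torusT (F.P K) 0) (fun κ z => unitsField (toUField W) ⟨z, κ⟩)
                (fun μ => covD (torusT (F.P K) 0) (fun κ z => unitsField (toUField W) ⟨z, κ⟩) μ (Ψ y)) z‖ ^ 2 else 0))
                ≤ ζ_R * (∑ p : Plaq (F.P K) 0, ‖((Complex.I • D ⟨p.src, p.μ⟩) + ((W ⟨p.src, p.μ⟩ : Matrix (Fin 2) (Fin 2) ℂ) * (Complex.I • D ⟨p.src.shift p.μ, p.ν⟩) * star (W ⟨p.src, p.μ⟩ : Matrix (Fin 2) (Fin 2) ℂ))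
            - (((W ⟨p.src, p.μ⟩ * W ⟨p.src.shift p.μ, p.ν⟩ * (W ⟨p.src.shift p.ν, p.μ⟩)⁻¹ : Matrix.specialUnitaryGroup (Fin 2) ℂ) : Matrix (Fin 2) (Fin 2) ℂ) * (Complex.I • D ⟨p.src.shift p.ν, p.μ⟩) * star ((W ⟨p.src, p.μ⟩ * W ⟨p.src.shift p.μ, p.ν⟩ * (W ⟨p.src.shift p.ν, p.μ⟩)⁻¹ : Matrix.specialUnitaryGroup (Fin 2) ℂ) : Matrix (Fin 2) (Fin 2) ℂ))
            - (((GaugeField.plaqHol W p : Matrix.specialUnitaryGroup (Fin 2) ℂ) : Matrix (Fin 2) (Fin 2) ℂ) * (Complex.I • D ⟨p.src, p.ν⟩) * star ((GaugeField.plaqHol W p : Matrix.specialUnitaryGroup (Fin 2) ℂ) : Matrix (Fin 2) (Fin 2) ℂ)))‖ ^ 2) + θ_R * e * (((F.L : ℝ) ^ (K - n)) ^ 2)⁻¹ * (∑ b : PBond (F.P K) 0, ‖D b‖ ^ 2) ∧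
              2 * (3 * (2 * ((F.P K).d : ℝ) * (6 / ((((F.P K).L ^ (K - n) : ℕ) : ℝ)))) * (3 / ((((F.P K).L ^ (K - n) : ℕ) : ℝ))))
                  * (∑ y : Site (F.P K) (K - n), ∑ z : Site (F.P K) 0,
              (if (∀ ν : Fin (F.P K).d,
                  (y ν = (iterBlockOf (K - n) (fun κ => z κ - (((((F.P K).L ^ (K - n) - 1) / 2 : ℕ)) : ZMod ((F.P K).sitesPerDir 0)))) ν - 1
                  ∨ y ν = (iterBlockOf (K - n) (fun κ => z κ - (((((F.P K).L ^ (K - n) - 1) / 2 : ℕ)) : ZMod ((F.P K).sitesPerDir 0)))) ν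
                  ∨ y ν = (iterBlockOf (K - n) (fun κ => z κ - (((((F.P K).L ^ (K - n) - 1) / 2 : ℕ)) : ZMod ((F.P K).sitesPerDir 0)))) ν + 1
                  ∨ y ν = (iterBlockOf (K - n) (fun κ => z κ - (((((F.P K).L ^ (K - n) - 1) / 2 : ℕ)) : ZMod ((F.P K).sitesPerDir 0)))) ν + 2))
                then ∑ μ : Fin (F.P K).d,
                  (‖covDstar (torusT (F.P K) 0) (fun κ z => unitsField (toUField W) ⟨z, κ⟩) μ (Ψ y) z‖ ^ 2
                    + ‖covD (torusT (F.P K) 0) (fun κ z => unitsField (toUField W) ⟨z, κ⟩) μ (Ψ y) z‖ ^ 2) else 0))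
                ≤ ζ_D * (∑ p : Plaq (F.P K) 0, ‖((Complex.I • D ⟨p.src, p.μ⟩) + ((W ⟨p.src, p.μ⟩ : Matrix (Fin 2) (Fin 2) ℂ) * (Complex.I • D ⟨p.src.shift p.μ, p.ν⟩) * star (W ⟨p.src, p.μ⟩ : Matrix (Fin 2) (Fin 2) ℂ))
            - (((W ⟨p.src, p.μ⟩ * W ⟨p.src.shift p.μ, p.ν⟩ * (W ⟨p.src.shift p.ν, p.μ⟩)⁻¹ : Matrix.specialUnitaryGroup (Fin 2) ℂ) : Matrix (Fin 2) (Fin 2) ℂ) * (Complex.I • D ⟨p.src.shift p.ν, p.μ⟩) * star ((W ⟨p.src, p.μ⟩ * W ⟨p.src.shift p.μ, p.ν⟩ * (W ⟨p.src.shift p.ν, p.μ⟩)⁻¹ : Matrix.specialUnitaryGroup (Fin 2) ℂ) : Matrix (Fin 2) (Fin 2) ℂ))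
            - (((GaugeField.plaqHol W p : Matrix.specialUnitaryGroup (Fin 2) ℂ) : Matrix (Fin 2) (Fin 2) ℂ) * (Complex.I • D ⟨p.src, p.ν⟩) * star ((GaugeField.plaqHol W p : Matrix.specialUnitaryGroup (Fin 2) ℂ) : Matrix (Fin 2) (Fin 2) ℂ)))‖ ^ 2) + θ_D * e * (((F.L : ℝ) ^ (K - n)) ^ 2)⁻¹ * (∑ b : PBond (F.P K) 0, ‖D b‖ ^ 2) ∧
              2 * (3 * (((F.P K).d : ℝ) * (24 / ((((F.P K).L ^ (K - n) : ℕ) : ℝ)) ^ 2) ^ 2))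
                  * (∑ y : Site (F.P K) (K - n), ∑ z : Site (F.P K) 0,
              (if (∀ ν : Fin (F.P K).d,
                  (y ν = (iterBlockOf (K - n) (fun κ => z κ - (((((F.P K).L ^ (K - n) - 1) / 2 : ℕ)) : ZMod ((F.P K).sitesPerDir 0)))) ν - 1
                  ∨ y ν = (iterBlockOf (K - n) (fun κ => z κ - (((((F.P K).L ^ (K - n) - 1) / 2 : ℕ)) : ZMod ((F.P K).sitesPerDir 0)))) ν
                  ∨ y ν = (iterBlockOf (K - n) (fun κ => z κ - (((((F.P K).L ^ (K - n) - 1) / 2 : ℕ)) : ZMod ((F.P K).sitesPerDir 0)))) ν + 1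
                  ∨ y ν = (iterBlockOf (K - n) (fun κ => z κ - (((((F.P K).L ^ (K - n) - 1) / 2 : ℕ)) : ZMod ((F.P K).sitesPerDir 0)))) ν + 2))
                then ∑ μ : Fin (F.P K).d, ‖Ψ y z - Z μ z‖ ^ 2 else 0))
                ≤ C_H * ((F.L : ℝ) ^ (K - n))⁻¹ * (∑ c : PBond (F.P K) (K - n), ∑ a : Fin 2, ∑ b : Fin 2,
                Complex.normSq ((φ₀ (embIter (K - n) c.src) - ((Averaging.iter (fun i => blockAvg (P := F.P K) (j := i) (expMeanLogSU (n := Fin 2))) (K - n) W c : Matrix.specialUnitaryGroup (Fin 2) ℂ) : Matrix (Fin 2) (Fin 2) ℂ)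
                    * φ₀ (embIter (K - n) c.tgt) * star ((Averaging.iter (fun i => blockAvg (P := F.P K) (j := i) (expMeanLogSU (n := Fin 2))) (K - n) W c : Matrix.specialUnitaryGroup (Fin 2) ℂ) : Matrix (Fin 2) (Fin 2) ℂ)) a b))
                  + ζ_G * (∑ p : Plaq (F.P K) 0, ‖((Complex.I • D ⟨p.src, p.μ⟩) + ((W ⟨p.src, p.μ⟩ : Matrix (Fin 2) (Fin 2) ℂ) * (Complex.I • D ⟨p.src.shift p.μ, p.ν⟩) * star (W ⟨p.src, p.μ⟩ : Matrix (Fin 2) (Fin 2) ℂ))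
            - (((W ⟨p.src, p.μ⟩ * W ⟨p.src.shift p.μ, p.ν⟩ * (W ⟨p.src.shift p.ν, p.μ⟩)⁻¹ : Matrix.specialUnitaryGroup (Fin 2) ℂ) : Matrix (Fin 2) (Fin 2) ℂ) * (Complex.I • D ⟨p.src.shift p.ν, p.μ⟩) * star ((W ⟨p.src, p.μ⟩ * W ⟨p.src.shift p.μ, p.ν⟩ * (W ⟨p.src.shift p.ν, p.μ⟩)⁻¹ : Matrix.specialUnitaryGroup (Fin 2) ℂ) : Matrix (Fin 2) (Fin 2) ℂ))
            - (((GaugeField.plaqHol W p : Matrix.specialUnitaryGroup (Fin 2) ℂ) : Matrix (Fin 2) (Fin 2) ℂ) * (Complex.I • D ⟨p.src, p.ν⟩) * star ((GaugeField.plaqHol W p : Matrix.specialUnitaryGroup (Fin 2) ℂ) : Matrix (Fin 2) (Fin 2) ℂ)))‖ ^ 2) + θ_G * e * (((F.L : ℝ) ^ (K - n)) ^ 2)⁻¹ * (∑ b : PBond (F.P K) 0, ‖D b‖ ^ 2)) ∧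
            -- ROW (P′) (DISPLAYED, booked): face-flux ∕ Poincaré row, free-θ mass term, ABSORBED DIVERGENCE SLOT `η·ℓ·DIV(D)`
            (∑ c : PBond (F.P K) (K - n), ∑ a : Fin 2, ∑ b : Fin 2,
                Complex.normSq ((φ₀ (embIter (K - n) c.src) - ((Averaging.iter (fun i => blockAvg (P := F.P K) (j := i) (expMeanLogSU (n := Fin 2))) (K - n) W c : Matrix.specialUnitaryGroup (Fin 2) ℂ) : Matrix (Fin 2) (Fin 2) ℂ)
                    * φ₀ (embIter (K - n) c.tgt) * star ((Averaging.iter (fun i => blockAvg (P := F.P K) (j := i) (expMeanLogSU (n := Fin 2))) (K - n) W c : Matrix.specialUnitaryGroup (Fin 2) ℂ) : Matrix (Fin 2) (Fin 2) ℂ)) a b))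
              ≤ ((F.L : ℝ) ^ (K - n)) * (ζ_P / θ) * (∑ p : Plaq (F.P K) 0, ‖((Complex.I • D ⟨p.src, p.μ⟩) + ((W ⟨p.src, p.μ⟩ : Matrix (Fin 2) (Fin 2) ℂ) * (Complex.I • D ⟨p.src.shift p.μ, p.ν⟩) * star (W ⟨p.src, p.μ⟩ : Matrix (Fin 2) (Fin 2) ℂ))
            - (((W ⟨p.src, p.μ⟩ * W ⟨p.src.shift p.μ, p.ν⟩ * (W ⟨p.src.shift p.ν, p.μ⟩)⁻¹ : Matrix.specialUnitaryGroup (Fin 2) ℂ) : Matrix (Fin 2) (Fin 2) ℂ) * (Complex.I • D ⟨p.src.shift p.ν, p.μ⟩) * star ((W ⟨p.src, p.μ⟩ * W ⟨p.src.shift p.μ, p.ν⟩ * (W ⟨p.src.shift p.ν, p.μ⟩)⁻¹ : Matrix.specialUnitaryGroup (Fin 2) ℂ) : Matrix (Fin 2) (Fin 2) ℂ))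
            - (((GaugeField.plaqHol W p : Matrix.specialUnitaryGroup (Fin 2) ℂ) : Matrix (Fin 2) (Fin 2) ℂ) * (Complex.I • D ⟨p.src, p.ν⟩) * star ((GaugeField.plaqHol W p : Matrix.specialUnitaryGroup (Fin 2) ℂ) : Matrix (Fin 2) (Fin 2) ℂ)))‖ ^ 2)
                + θ * ((F.L : ℝ) ^ (K - n))⁻¹ * (∑ b : PBond (F.P K) 0, ‖D b‖ ^ 2)
                + θ_P * e * ((F.L : ℝ) ^ (K - n))⁻¹ * (∑ b : PBond (F.P K) 0, ‖D b‖ ^ 2)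
                + C_P * ((F.L : ℝ) ^ (K - n)) * (∑ b : PBond (F.P K) 0, ∑ ν : Fin (F.P K).d,
                ‖((W ⟨b.src, ν⟩ : Matrix.specialUnitaryGroup (Fin 2) ℂ) : Matrix (Fin 2) (Fin 2) ℂ) * B ⟨b.src.shift ν, b.dir⟩ * star ((W ⟨b.src, ν⟩ : Matrix.specialUnitaryGroup (Fin 2) ℂ) : Matrix (Fin 2) (Fin 2) ℂ) - B b‖ ^ 2)
                + C_Λ * ((F.L : ℝ) ^ (K - n)) * (∑ x : Site (F.P K) 0, ∑ μ : Fin (F.P K).d, ∑ ν : Fin (F.P K).d,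
                (if μ < ν then ∑ j : Fin 2, ∑ k : Fin 2, ‖(curl (torusT (F.P K) 0) (fun κ z => unitsField (toUField W) ⟨z, κ⟩) (fun κ z => B ⟨z, κ⟩) μ ν x) j k‖ ^ 2 else 0))
                + η * ((F.L : ℝ) ^ (K - n)) * (∑ x : Site (F.P K) 0, ∑ j : Fin 2, ∑ k : Fin 2,
              ‖(divB (torusT (F.P K) 0) (fun κ z => unitsField (toUField W) ⟨z, κ⟩) (fun κ z => Complex.I • D ⟨z, κ⟩) x) j k‖ ^ 2))) :
    ∀ (L : ℕ), 1 < L → ∀ (B₃ : ℝ), 4 < B₃ →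
    ∃ e₅ a₁'' : ℝ, 0 < e₅ ∧ 0 < a₁'' ∧ ∀ (i : Idx L) (e ε₁ : ℝ) (V : GaugeField (i.1.1.P i.1.2.1) 0 (Matrix.specialUnitaryGroup (Fin 2) ℂ))
      (U₀ W : GaugeField (i.1.1.P i.1.2.2) 0 (Matrix.specialUnitaryGroup (Fin 2) ℂ)),
      0 < ε₁ → ε₁ ≤ a₁'' → PlaqSmall ε₁ V → (L : ℝ) ^ 3 * B₃ * ε₁ ≤ e → e ≤ e₅ →
      RegPr i.1.1 i.1.2.1 i.1.2.2 ((L : ℝ) ^ 3 * B₃ * ε₁) U₀ → CloseAvg i.1.1 i.1.2.1 i.1.2.2 i.2.2.le ((L : ℝ) ^ 3 * ε₁) V U₀ →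
      W ∈ regFibrePr i.1.1 i.1.2.1 i.1.2.2 i.2.2.le e V → IsCritR2 i.1.1 i.1.2.1 i.1.2.2 i.2.2.le V W →
        IsMinOn (fun W' : GaugeField (i.1.1.P i.1.2.2) 0 (Matrix.specialUnitaryGroup (Fin 2) ℂ) => wilsonAction4 W')
          (regFibrePr i.1.1 i.1.2.1 i.1.2.2 i.2.2.le e V) W := by
  refine stub_PV3E_of_pinnedSliceAndEngineRows_abs ?_
  intro L hL
  obtain ⟨e₆, sQ, ζ, δ₁, he₆, he₆L, hsQ0, hsQ8, hsQL, hζ0, hδ0, hδκ, hwin1, hwin2, hE1,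
    C_H, ζ_R, θ_R, ζ_D, θ_D, ζ_G, θ_G, ζ_P, θ, θ_P, C_P, C_Λ, C_g, θ_g, η,
    hCH, hθR, hθD, hθG, hθ, hθP, hCP, hCΛ, hθg, habs, hζ, hδ, H⟩ := hrows L hL
  refine ⟨e₆, sQ, ζ, δ₁, he₆, he₆L, hsQ0, hsQ8, hsQL, hζ0, hδ0, hδκ, hwin1, hwin2, hE1,
    C_H, ζ_R + ζ_D + ζ_G, θ_R + θ_D + θ_G, ζ_P, θ, θ_P, C_P, C_Λ, 16 * (1 + C_g), 16 * θ_g + 792, η,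
    hCH, by positivity, hθ, hθP, hCP, hCΛ, by positivity, habs, hζ, hδ, ?_⟩
  intro F hF n K hnK e V W he hhe hW hWcrit Y hY hsup hSH D hD B φ₀ hsplit hBc
  obtain ⟨hKg, ⟨Ψ, Z, hΨ, hRes, hDir, hGJ⟩, hP⟩ := H F hF n K hnK e V W he hhe hW hWcrit Y hY hsup hSH D hD B φ₀ hsplit hBc
  have hL1 : 1 < F.L := F.hL.2
  have hKn : K - n ≠ 0 := by omega
  have hk : K - n ≤ (F.P K).m + (F.P K).K := by
    show K - n ≤ F.m + K
    omega
  have hℓ2 : 2 ≤ (F.P K).L ^ (K - n) := by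
    show 2 ≤ F.L ^ (K - n)
    have := Nat.one_lt_pow hKn hL1
    omega
  have hL1r : (1 : ℝ) ≤ (L : ℝ) := by exact_mod_cast hL.le
  have he1 : e ≤ 1 := by
    have h9 : (1 : ℝ) ≤ (L : ℝ) ^ 9 := one_le_pow₀ hL1r
    nlinarith
  have hSH' : ∀ x : Site (F.P K) 0, x ∉ Set.range (embIter (K - n)) →
      divB (torusT (F.P K) 0) (fun κ z => unitsField (toUField W) ⟨z, κ⟩) (fun μ z => covD (torusT (F.P K) 0) (fun κ z => unitsField (toUField W) ⟨z, κ⟩) μ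
        (fun y => divB (torusT (F.P K) 0) (fun κ z => unitsField (toUField W) ⟨z, κ⟩) (fun κ z => Complex.I • D ⟨z, κ⟩) y) z) x = 0 := by
    subst hD
    exact hSH
  have hψ : ∀ x : Site (F.P K) 0, x ∉ Set.range (embIter (K - n)) →
      divB (torusT (F.P K) 0) (fun κ z => unitsField (toUField W) ⟨z, κ⟩) (fun κ y => covD (torusT (F.P K) 0) (fun κ z => unitsField (toUField W) ⟨z, κ⟩) κ
        (fun z => divB (torusT (F.P K) 0) (fun κ z => unitsField (toUField W) ⟨z, κ⟩) (fun ν w => covD (torusT (F.P K) 0) (fun κ z => unitsField (toUField W) ⟨z, κ⟩) ν φ₀ w) z) y) x = 0 :=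
    fun x hx => covLapLap_eq_zero_of_split (fun κ z => unitsField (toUField W) ⟨z, κ⟩) D B φ₀ hsplit hBc x (hSH' x hx)
  refine ⟨?_, hP, ?_⟩
  · exact rowH_of_localModelRows_pt F K n hk hℓ2 W φ₀ hψ ⟨Ψ, Z, hΨ, hRes, hDir, hGJ⟩
  · have hKg' := hKg (fun b => covD (torusT (F.P K) 0) (fun κ z => unitsField (toUField W) ⟨z, κ⟩) b.dir φ₀ b.src) (fun _ => rfl)
    exact rowB_of_hKgK_T3 F K n W he.le he1 (dist1_plaqHol_le_of_mem_regFibrePr F hnK.le hW) D B φ₀ hsplit hBc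
      (fun b => covD (torusT (F.P K) 0) (fun κ z => unitsField (toUField W) ⟨z, κ⟩) b.dir φ₀ b.src) (fun _ => rfl) hKg'

end Summit.QuantumFields.YangMills.Theorems.Prop7PV3EOfPinnedSliceAndRawRowsAbs

end
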